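/-
Origin: expansion seat `planner-pub-hodgecm-pv05-g3-0`, handover #7 v5 2026-08-18T07:09:14Z (`HOME/pub-hodgecm-pv05-g3/lean/Pv05g3/FockAtoms.lean`, md5 7bbcea7c, 317 lines);
landed by the gen-7 packager in gate run 25 REPLACES the earlier landed copy of `HodgeCM/PerL34/FockAtoms.lean` (verbatim).
-/
/-
Origin: HOME/pub-hodgecm-pv05-g3/lean/Pv05g3/FockAtoms.lean — session planner-pub-hodgecm-pv05-g3-0 (unit pub-hodgecm-pv05-g3,
DAG-NODE PROVER #05 gen 3), 7th deliverable.  Intended final place: `HodgeCM/PerL34/FockAtoms.lean`, after this seat's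
`FockLattice.lean` (imports the LANDED `HodgeCM.PerL34.FockLattice`; no rewrite needed).  Imports
`Mathlib.Order.Atoms` + `HodgeCM.PerL34.FockLattice` only; nothing cited, nothing asserted, no hypotheses.
-/
import Mathlib.Order.Atoms
import Summits.HodgeConjecture.HodgeCM.PerL34.FockLattice_2

set_option autoImplicit false

/-!
# Howe duality as a classification of the minimal `𝔤𝔩₃(ℂ)`-submodules of `ℂ[z₁, z₂, w]`: the atoms are exactly the `F_k`

KERNEL, hypothesis-free.  With the (scoped) Lie-module structure of `FockLieModule` (`⁅A, f⁆ = oscRep A f`), in the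
complete lattice `LieSubmodule ℂ (Matrix HarmVar HarmVar ℂ) HarmModel`:

* `eq_bot_or_eq_of_le_fockPiece` : a `𝔤𝔩₃`-submodule contained in `F_k` is `⊥` or `F_k`;
* `fockPiece_ne_bot`, **`fockPiece_isAtom k : IsAtom (fockPiece k)`**;
* **`isAtom_iff_eq_fockPiece N : IsAtom N ↔ ∃ k : ℤ, N = fockPiece k`** — the minimal (= irreducible) `𝔤𝔩₃(ℂ)`-submodules
  of the Fock space `ℂ[z₁,z₂,w]` are exactly the `U(1)`-isotypic pieces `F_k`, `k ∈ ℤ`: the bijection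
  `k ↔ F_k` between the characters of `U(1)` occurring and the irreducible `𝔤𝔩₃`-submodules (Howe duality for the
  pair `(U(1), U(2,1))` in its lattice form; combine with `fockPiece_hom_eq_zero` for pairwise non-isomorphy and
  `oscRep_stable_iff` for the full lattice `𝒫(ℤ)`).

The definite pair `(U(1), U(3))` symmetrically: `eq_bot_or_eq_of_le_symPiece`, `symPiece_ne_bot`, **`symPiece_isAtom`**,
**`isAtom_iff_eq_symPiece N : IsAtom N ↔ ∃ d : ℕ, N = symPiece d`** (the minimal `𝔤𝔩₃`-submodules of `ℂ[z₁,z₂,z₃]` are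
exactly the `Sym^d`); and atomisticity `lieSubmodule_eq_sSup_atoms : N = sSup {A | IsAtom A ∧ A ≤ N}` for `ℂ[z₁,z₂,w]`.

**Complete reducibility**: `iSup_hpiece_inf_eq_bot` (partial sums over disjoint index sets are disjoint),
`iSup_hpiece_sup_compl`, `isCompl_iSup_hpiece S : IsCompl (⊕_{k∈S} F_k) (⊕_{k∉S} F_k)`, `lieSubmodule_exists_isCompl` (every
`𝔤𝔩₃`-submodule of `ℂ[z₁,z₂,w]` has a `𝔤𝔩₃`-stable complement), **`complementedLattice : ComplementedLattice
(LieSubmodule ℂ (Matrix HarmVar HarmVar ℂ) HarmModel)`** — the Fock space is a semisimple `𝔤𝔩₃(ℂ)`-module whose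
simple constituents are the `F_k` (atoms), each occurring once; and for the definite pair `iSup_dpiece_eq_top`,
`iSup_dpiece_inf_eq_bot`, `iSup_dpiece_sup_compl`, `isCompl_iSup_dpiece`, `lieSubmodule_exists_isCompl_def`,
**`complementedLattice_def`** (`ℂ[z₁,z₂,z₃]` semisimple over `𝔤𝔩₃(ℂ)`, constituents the `Sym^d`).

Helpers: `wtSet_mono`, `iSup_hpiece_singleton`, `wtSet_hpiece`, `iSup_hpiece_empty`, `fockPiece_toSubmodule`,
`degSet_mono`, `iSup_dpiece_singleton`, `degSet_dpiece`, `iSup_dpiece_empty`, `symPiece_toSubmodule`.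
Residual: DICTIONARY only (as for `FockLattice`): identification of `oscRep` with the printed Fock model.
-/

namespace HodgeCM

namespace PerL34

namespace Fock

open MvPolynomial Finsupp

section Atoms
attribute [local instance 100] LieRing.ofAssociativeRing

/-- (Ported verbatim from the HodgeCMPerL package; no docstring in the source.) -/
theorem wtSet_mono {M M' : Submodule ℂ HarmModel} (h : M ≤ M') : wtSet M ⊆ wtSet M' := by
  intro k hk hbot
  exact hk (eq_bot_iff.mpr (le_trans (inf_le_inf_right _ h) (le_of_eq hbot)))

/-- (Ported verbatim from the HodgeCMPerL package; no docstring in the source.) -/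
theorem iSup_hpiece_singleton (k : ℤ) : (⨆ j ∈ ({k} : Set ℤ), hpiece j) = hpiece k := by
  apply le_antisymm
  · exact iSup₂_le fun j hj => by rw [Set.mem_singleton_iff.mp hj]
  · exact le_iSup₂_of_le k (Set.mem_singleton k) le_rfl

/-- (Ported verbatim from the HodgeCMPerL package; no docstring in the source.) -/
theorem wtSet_hpiece (k : ℤ) : wtSet (hpiece k) = {k} := by
  rw [← iSup_hpiece_singleton, wtSet_iSup_hpiece]

/-- (Ported verbatim from the HodgeCMPerL package; no docstring in the source.) -/
theorem iSup_hpiece_empty : (⨆ j ∈ (∅ : Set ℤ), hpiece j) = ⊥ := by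
  simp

/-- (Ported verbatim from the HodgeCMPerL package; no docstring in the source.) -/
theorem fockPiece_toSubmodule (k : ℤ) :
    ((fockPiece k : LieSubmodule ℂ (Matrix HarmVar HarmVar ℂ) HarmModel) : Submodule ℂ HarmModel) = hpiece k := rfl

/-- a `𝔤𝔩₃`-submodule contained in `F_k` is `0` or `F_k` -/
theorem eq_bot_or_eq_of_le_fockPiece (k : ℤ) (N : LieSubmodule ℂ (Matrix HarmVar HarmVar ℂ) HarmModel)
    (hN : N ≤ fockPiece k) : N = ⊥ ∨ N = fockPiece k := by
  obtain ⟨S, hS⟩ := lieSubmodule_eq_iSup N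
  have hle : (N : Submodule ℂ HarmModel) ≤ hpiece k := by
    rw [← fockPiece_toSubmodule, LieSubmodule.toSubmodule_le_toSubmodule]; exact hN
  have hSk : S ⊆ {k} := by
    have := wtSet_mono hle
    rwa [hS, wtSet_iSup_hpiece, wtSet_hpiece] at this
  rcases Set.subset_singleton_iff_eq.mp hSk with hS0 | hS1
  · left
    rw [← LieSubmodule.toSubmodule_eq_bot, hS, hS0, iSup_hpiece_empty]
  · right
    rw [← LieSubmodule.toSubmodule_inj, hS, hS1, iSup_hpiece_singleton, fockPiece_toSubmodule]

/-- (Ported verbatim from the HodgeCMPerL package; no docstring in the source.) -/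
theorem fockPiece_ne_bot (k : ℤ) : (fockPiece k : LieSubmodule ℂ (Matrix HarmVar HarmVar ℂ) HarmModel) ≠ ⊥ := by
  rw [Ne, ← LieSubmodule.toSubmodule_eq_bot, fockPiece_toSubmodule]
  exact hpiece_ne_bot k

/-- **each `F_k` is an atom of the lattice of `𝔤𝔩₃(ℂ)`-submodules of `ℂ[z₁,z₂,w]`** -/
theorem fockPiece_isAtom (k : ℤ) : IsAtom (fockPiece k : LieSubmodule ℂ (Matrix HarmVar HarmVar ℂ) HarmModel) := by
  refine ⟨fockPiece_ne_bot k, fun N hN => ?_⟩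
  rcases eq_bot_or_eq_of_le_fockPiece k N hN.le with h | h
  · exact h
  · exact absurd h hN.ne

/-- **Howe duality as a classification of the minimal submodules**: the atoms of the lattice of
`𝔤𝔩₃(ℂ)`-submodules of `ℂ[z₁,z₂,w]` (= the irreducible submodules) are exactly the `F_k`, `k ∈ ℤ`. -/
theorem isAtom_iff_eq_fockPiece (N : LieSubmodule ℂ (Matrix HarmVar HarmVar ℂ) HarmModel) :
    IsAtom N ↔ ∃ k : ℤ, N = fockPiece k := by
  constructor
  · intro hN
    obtain ⟨S, hS⟩ := lieSubmodule_eq_iSup N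
    have hSne : S.Nonempty := by
      rw [Set.nonempty_iff_ne_empty]
      rintro rfl
      apply hN.1
      rw [← LieSubmodule.toSubmodule_eq_bot, hS, iSup_hpiece_empty]
    obtain ⟨k, hk⟩ := hSne
    refine ⟨k, ?_⟩
    have hle : fockPiece k ≤ N := by
      rw [← LieSubmodule.toSubmodule_le_toSubmodule, fockPiece_toSubmodule, hS]
      exact le_iSup₂_of_le k hk le_rfl
    rcases hle.lt_or_eq with hlt | heq
    · exact absurd (hN.2 _ hlt) (fockPiece_ne_bot k)
    · exact heq.symm
  · rintro ⟨k, rfl⟩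
    exact fockPiece_isAtom k

end Atoms

section AtomsDef
attribute [local instance 100] LieRing.ofAssociativeRing

/-- (Ported verbatim from the HodgeCMPerL package; no docstring in the source.) -/
theorem degSet_mono {M M' : Submodule ℂ DefModel} (h : M ≤ M') : degSet M ⊆ degSet M' := by
  intro d hd hbot
  exact hd (eq_bot_iff.mpr (le_trans (inf_le_inf_right _ h) (le_of_eq hbot)))

/-- (Ported verbatim from the HodgeCMPerL package; no docstring in the source.) -/
theorem iSup_dpiece_singleton (d : ℕ) : (⨆ j ∈ ({d} : Set ℕ), dpiece j) = dpiece d := by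
  apply le_antisymm
  · exact iSup₂_le fun j hj => by rw [Set.mem_singleton_iff.mp hj]
  · exact le_iSup₂_of_le d (Set.mem_singleton d) le_rfl

/-- (Ported verbatim from the HodgeCMPerL package; no docstring in the source.) -/
theorem degSet_dpiece (d : ℕ) : degSet (dpiece d) = {d} := by
  rw [← iSup_dpiece_singleton, degSet_iSup_dpiece]

/-- (Ported verbatim from the HodgeCMPerL package; no docstring in the source.) -/
theorem iSup_dpiece_empty : (⨆ j ∈ (∅ : Set ℕ), dpiece j) = ⊥ := by
  simp

/-- (Ported verbatim from the HodgeCMPerL package; no docstring in the source.) -/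
theorem symPiece_toSubmodule (d : ℕ) :
    ((symPiece d : LieSubmodule ℂ (Matrix (Fin 3) (Fin 3) ℂ) DefModel) : Submodule ℂ DefModel) = dpiece d := rfl

/-- a `𝔤𝔩₃`-submodule contained in `Sym^d` is `0` or `Sym^d` -/
theorem eq_bot_or_eq_of_le_symPiece (d : ℕ) (N : LieSubmodule ℂ (Matrix (Fin 3) (Fin 3) ℂ) DefModel)
    (hN : N ≤ symPiece d) : N = ⊥ ∨ N = symPiece d := by
  obtain ⟨S, hS⟩ := lieSubmodule_eq_iSup_def N
  have hle : (N : Submodule ℂ DefModel) ≤ dpiece d := by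
    rw [← symPiece_toSubmodule, LieSubmodule.toSubmodule_le_toSubmodule]; exact hN
  have hSd : S ⊆ {d} := by
    have := degSet_mono hle
    rwa [hS, degSet_iSup_dpiece, degSet_dpiece] at this
  rcases Set.subset_singleton_iff_eq.mp hSd with hS0 | hS1
  · left
    rw [← LieSubmodule.toSubmodule_eq_bot, hS, hS0, iSup_dpiece_empty]
  · right
    rw [← LieSubmodule.toSubmodule_inj, hS, hS1, iSup_dpiece_singleton, symPiece_toSubmodule]

/-- (Ported verbatim from the HodgeCMPerL package; no docstring in the source.) -/
theorem symPiece_ne_bot (d : ℕ) : (symPiece d : LieSubmodule ℂ (Matrix (Fin 3) (Fin 3) ℂ) DefModel) ≠ ⊥ := by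
  rw [Ne, ← LieSubmodule.toSubmodule_eq_bot, symPiece_toSubmodule]
  exact dpiece_ne_bot d

/-- **each `Sym^d ℂ³` is an atom of the lattice of `𝔤𝔩₃(ℂ)`-submodules of `ℂ[z₁,z₂,z₃]`** -/
theorem symPiece_isAtom (d : ℕ) : IsAtom (symPiece d : LieSubmodule ℂ (Matrix (Fin 3) (Fin 3) ℂ) DefModel) := by
  refine ⟨symPiece_ne_bot d, fun N hN => ?_⟩
  rcases eq_bot_or_eq_of_le_symPiece d N hN.le with h | h
  · exact h
  · exact absurd h hN.ne

/-- **definite pair `(U(1), U(3))`**: the minimal `𝔤𝔩₃(ℂ)`-submodules of `ℂ[z₁,z₂,z₃]` are exactly the `Sym^d`, `d ∈ ℕ`. -/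
theorem isAtom_iff_eq_symPiece (N : LieSubmodule ℂ (Matrix (Fin 3) (Fin 3) ℂ) DefModel) :
    IsAtom N ↔ ∃ d : ℕ, N = symPiece d := by
  constructor
  · intro hN
    obtain ⟨S, hS⟩ := lieSubmodule_eq_iSup_def N
    have hSne : S.Nonempty := by
      rw [Set.nonempty_iff_ne_empty]
      rintro rfl
      apply hN.1
      rw [← LieSubmodule.toSubmodule_eq_bot, hS, iSup_dpiece_empty]
    obtain ⟨d, hd⟩ := hSne
    refine ⟨d, ?_⟩
    have hle : symPiece d ≤ N := by
      rw [← LieSubmodule.toSubmodule_le_toSubmodule, symPiece_toSubmodule, hS]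
      exact le_iSup₂_of_le d hd le_rfl
    rcases hle.lt_or_eq with hlt | heq
    · exact absurd (hN.2 _ hlt) (symPiece_ne_bot d)
    · exact heq.symm
  · rintro ⟨d, rfl⟩
    exact symPiece_isAtom d

/-- and the two lattices are atomistic: every `𝔤𝔩₃`-submodule is the join of the atoms below it -/
theorem lieSubmodule_eq_sSup_atoms (N : LieSubmodule ℂ (Matrix HarmVar HarmVar ℂ) HarmModel) :
    N = sSup {A | IsAtom A ∧ A ≤ N} := by
  obtain ⟨S, hS⟩ := lieSubmodule_eq_iSup N
  apply le_antisymm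
  · rw [← LieSubmodule.toSubmodule_le_toSubmodule, hS]
    refine iSup₂_le fun k hk => ?_
    have hle : fockPiece k ≤ N := by
      rw [← LieSubmodule.toSubmodule_le_toSubmodule, fockPiece_toSubmodule, hS]
      exact le_iSup₂_of_le k hk le_rfl
    have h2 : fockPiece k ≤ sSup {A | IsAtom A ∧ A ≤ N} := le_sSup ⟨fockPiece_isAtom k, hle⟩
    rw [← LieSubmodule.toSubmodule_le_toSubmodule, fockPiece_toSubmodule] at h2
    exact h2
  · exact sSup_le fun A hA => hA.2

end AtomsDef

section Semisimple
attribute [local instance 100] LieRing.ofAssociativeRing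

/-- two partial sums over DISJOINT index sets are disjoint subspaces -/
theorem iSup_hpiece_inf_eq_bot {S T : Set ℤ} (hST : Disjoint S T) :
    (⨆ k ∈ S, hpiece k) ⊓ (⨆ k ∈ T, hpiece k) = ⊥ := by
  set M : Submodule ℂ HarmModel := (⨆ k ∈ S, hpiece k) ⊓ (⨆ k ∈ T, hpiece k) with hM
  have hstab : ∀ A : Matrix HarmVar HarmVar ℂ, ∀ f ∈ M, oscRep A f ∈ M := fun A f hf =>
    ⟨iSup_hpiece_stable S A f hf.1, iSup_hpiece_stable T A f hf.2⟩
  have hW : wtSet M ⊆ S ∩ T := by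
    intro k hk
    exact ⟨by simpa [wtSet_iSup_hpiece] using wtSet_mono (inf_le_left : M ≤ _) hk,
      by simpa [wtSet_iSup_hpiece] using wtSet_mono (inf_le_right : M ≤ _) hk⟩
  have hW0 : wtSet M = ∅ := Set.eq_empty_of_subset_empty (hW.trans (Set.disjoint_iff.mp hST))
  rw [eq_iSup_of_oscRep_stable M hstab, hW0]
  simp

/-- complementary partial sums span everything -/
theorem iSup_hpiece_sup_compl (S : Set ℤ) : (⨆ k ∈ S, hpiece k) ⊔ (⨆ k ∈ Sᶜ, hpiece k) = ⊤ := by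
  rw [eq_top_iff, ← iSup_hpiece_eq_top]
  refine iSup_le fun k => ?_
  by_cases hk : k ∈ S
  · exact le_sup_of_le_left (le_iSup₂_of_le k hk le_rfl)
  · exact le_sup_of_le_right (le_iSup₂_of_le k hk le_rfl)

/-- **every partial sum has the complementary partial sum as a complement** -/
theorem isCompl_iSup_hpiece (S : Set ℤ) : IsCompl (⨆ k ∈ S, hpiece k) (⨆ k ∈ Sᶜ, hpiece k) :=
  ⟨_root_.disjoint_iff.mpr (iSup_hpiece_inf_eq_bot disjoint_compl_right), codisjoint_iff.mpr (iSup_hpiece_sup_compl S)⟩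

/-- **Complete reducibility: the lattice of `𝔤𝔩₃(ℂ)`-submodules of `ℂ[z₁,z₂,w]` is complemented** — every submodule
`⊕_{k∈S} F_k` has the complement `⊕_{k∉S} F_k`; with `isAtom_iff_eq_fockPiece` the Fock space is a semisimple
`𝔤𝔩₃`-module whose simple constituents are the `F_k`, each with multiplicity one. -/
theorem lieSubmodule_exists_isCompl (N : LieSubmodule ℂ (Matrix HarmVar HarmVar ℂ) HarmModel) :
    ∃ N' : LieSubmodule ℂ (Matrix HarmVar HarmVar ℂ) HarmModel, IsCompl N N' := by
  obtain ⟨S, hS⟩ := lieSubmodule_eq_iSup N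
  let N' : LieSubmodule ℂ (Matrix HarmVar HarmVar ℂ) HarmModel :=
    { (⨆ k ∈ Sᶜ, hpiece k : Submodule ℂ HarmModel) with
      lie_mem := fun {A f} hf => iSup_hpiece_stable Sᶜ A f hf }
  have hN' : (N' : Submodule ℂ HarmModel) = ⨆ k ∈ Sᶜ, hpiece k := rfl
  refine ⟨N', ?_, ?_⟩
  · rw [_root_.disjoint_iff, ← LieSubmodule.toSubmodule_inj, LieSubmodule.inf_toSubmodule, hS, hN',
      LieSubmodule.bot_toSubmodule]
    exact iSup_hpiece_inf_eq_bot disjoint_compl_right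
  · rw [codisjoint_iff, ← LieSubmodule.toSubmodule_inj, LieSubmodule.sup_toSubmodule, hS, hN',
      LieSubmodule.top_toSubmodule]
    exact iSup_hpiece_sup_compl S

/-- (Ported verbatim from the HodgeCMPerL package; no docstring in the source.) -/
theorem complementedLattice : ComplementedLattice (LieSubmodule ℂ (Matrix HarmVar HarmVar ℂ) HarmModel) :=
  ⟨lieSubmodule_exists_isCompl⟩

end Semisimple

section SemisimpleDef
attribute [local instance 100] LieRing.ofAssociativeRing

/-- (Ported verbatim from the HodgeCMPerL package; no docstring in the source.) -/
theorem iSup_dpiece_eq_top : ⨆ d : ℕ, dpiece d = ⊤ :=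
  dpiece_isInternal.submodule_iSup_eq_top

/-- (Ported verbatim from the HodgeCMPerL package; no docstring in the source.) -/
theorem iSup_dpiece_inf_eq_bot {S T : Set ℕ} (hST : Disjoint S T) :
    (⨆ d ∈ S, dpiece d) ⊓ (⨆ d ∈ T, dpiece d) = ⊥ := by
  set M : Submodule ℂ DefModel := (⨆ d ∈ S, dpiece d) ⊓ (⨆ d ∈ T, dpiece d) with hM
  have hstab : ∀ A : Matrix (Fin 3) (Fin 3) ℂ, ∀ f ∈ M, dERep A f ∈ M := fun A f hf =>
    ⟨iSup_dpiece_stable S A f hf.1, iSup_dpiece_stable T A f hf.2⟩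
  have hW : degSet M ⊆ S ∩ T := by
    intro d hd
    exact ⟨by simpa [degSet_iSup_dpiece] using degSet_mono (inf_le_left : M ≤ _) hd,
      by simpa [degSet_iSup_dpiece] using degSet_mono (inf_le_right : M ≤ _) hd⟩
  have hW0 : degSet M = ∅ := Set.eq_empty_of_subset_empty (hW.trans (Set.disjoint_iff.mp hST))
  rw [eq_iSup_of_dERep_stable M hstab, hW0]
  simp

/-- (Ported verbatim from the HodgeCMPerL package; no docstring in the source.) -/
theorem iSup_dpiece_sup_compl (S : Set ℕ) : (⨆ d ∈ S, dpiece d) ⊔ (⨆ d ∈ Sᶜ, dpiece d) = ⊤ := by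
  rw [eq_top_iff, ← iSup_dpiece_eq_top]
  refine iSup_le fun d => ?_
  by_cases hd : d ∈ S
  · exact le_sup_of_le_left (le_iSup₂_of_le d hd le_rfl)
  · exact le_sup_of_le_right (le_iSup₂_of_le d hd le_rfl)

/-- (Ported verbatim from the HodgeCMPerL package; no docstring in the source.) -/
theorem isCompl_iSup_dpiece (S : Set ℕ) : IsCompl (⨆ d ∈ S, dpiece d) (⨆ d ∈ Sᶜ, dpiece d) :=
  ⟨_root_.disjoint_iff.mpr (iSup_dpiece_inf_eq_bot disjoint_compl_right),
    codisjoint_iff.mpr (iSup_dpiece_sup_compl S)⟩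

/-- **definite pair: `ℂ[z₁,z₂,z₃]` is a semisimple `𝔤𝔩₃(ℂ)`-module** (complemented submodule lattice; simple
constituents the `Sym^d`, each once). -/
theorem lieSubmodule_exists_isCompl_def (N : LieSubmodule ℂ (Matrix (Fin 3) (Fin 3) ℂ) DefModel) :
    ∃ N' : LieSubmodule ℂ (Matrix (Fin 3) (Fin 3) ℂ) DefModel, IsCompl N N' := by
  obtain ⟨S, hS⟩ := lieSubmodule_eq_iSup_def N
  let N' : LieSubmodule ℂ (Matrix (Fin 3) (Fin 3) ℂ) DefModel :=
    { (⨆ d ∈ Sᶜ, dpiece d : Submodule ℂ DefModel) with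
      lie_mem := fun {A f} hf => iSup_dpiece_stable Sᶜ A f hf }
  have hN' : (N' : Submodule ℂ DefModel) = ⨆ d ∈ Sᶜ, dpiece d := rfl
  refine ⟨N', ?_, ?_⟩
  · rw [_root_.disjoint_iff, ← LieSubmodule.toSubmodule_inj, LieSubmodule.inf_toSubmodule, hS, hN',
      LieSubmodule.bot_toSubmodule]
    exact iSup_dpiece_inf_eq_bot disjoint_compl_right
  · rw [codisjoint_iff, ← LieSubmodule.toSubmodule_inj, LieSubmodule.sup_toSubmodule, hS, hN',
      LieSubmodule.top_toSubmodule]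
    exact iSup_dpiece_sup_compl S

/-- (Ported verbatim from the HodgeCMPerL package; no docstring in the source.) -/
theorem complementedLattice_def : ComplementedLattice (LieSubmodule ℂ (Matrix (Fin 3) (Fin 3) ℂ) DefModel) :=
  ⟨lieSubmodule_exists_isCompl_def⟩

end SemisimpleDef

end Fock

end PerL34

end HodgeCM
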